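/-
Copyright (c) 2026 the pub-hodgecm-mathlib formalisation cell (harness21).  Prover seat hodgecm-mathlib-K2E3-p06 (g4), Track B «K2-LIT», engine E3, unit U4 «Keys»; deal (D61)
LINE LEAD of the open leaf (U4f-χ₁-ram-one), design D-I v2, plan step Z2A-3c (i) «THE CM LETTERS `hw`, `hN`, `hdich`, `hθ` OF THE BRANCH A CONTRADICTION» along `eA`; 2026-09-04.
KERNEL module: THEOREMS ONLY (no definition, no named fact, no `sorry`, no instance, no notation).
-/
import Summits.HodgeConjecture.HodgeConjecture.Theorems.K2E3DepthZeroIwahoriCharacterCM     -- ★ Z2A-3b p858364 (this seat): `coe_eA_apply`, `map_weyl_eq_weylLongU`, `map_mem_unipotentU_of_mem`, `theta_eq_one_of_mem_map`; brings ★ Z2A-3a, ★ Z2A-1, the frame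
import HarnessLib

/-!
# K2 ∕ E3 «EllipticInputs», unit U4 «Keys» — (U4f-χ₁-ram-one) step Z2A-3c (i): THE LETTERS OF ★ Z2A-4 `K2E3BranchAContradiction.false_of_typeVector_of_integral_eq_zero`
# ON `U(Φ₃)(L⁺_v)` — `w₀² = 1`, `N` closed, the dichotomy «`w₀ n w₀ ∈ I` or `∈ P·w₀·I`», and `θ(w₀ n w₀) = 1` on `I`   [BruhatTits1972 (4.4.4); Casselman1995 §6.4]

Cell hodgecm-mathlib (D-0151), FLOOR 0, Track B «K2-LIT», engine E3, crux item H413 = stmt-HodgeConjecture-24833 (route `HCCMUnconditional`, no route verbs); target BY NAME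
the OPEN leaf `…K2E3EllipticInputs.U4Keys.sig_K2E3KeysThmTwoContractingRamifiedCharOne` (U4Keys ED. 7), design D-I v2, plan step Z2A (Branch A), CM dress.  Author K2E3-p06 (g4),
line lead (D61).  `--supports stmt-HodgeConjecture-24833 --as helper`; THEOREMS ONLY.  NOT THE PAYER.

THE POINT.  ★ Z2A-4 (generic) derives `False` from an `(I, θ)`-type vector killed by `Λ_{w₀}` once it is fed, on `G = U(Φ₃)(L⁺_v)`: `hw : w₀·w₀ ∈ I`, `hN : N closed`,
`hdich : ∀ n ∈ N, w₀ n w₀ ∈ I ∨ w₀ n w₀ ∈ P·w₀·I`, `hθ : θ(w₀ n w₀) = 1 when w₀ n w₀ ∈ I` (plus `I` compact open = ★ `isOpen_isCompact_levels`, the disagreeing torus element and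
the type vector — next files).  THIS FILE supplies these four letters in the (G3)-EXPLICIT frame `(w hw eA heA ϖ hϖ g₁ hg₁ K₀ K₁ I hK₀ hK₁ hI)` with `(t, ht : t = cmBorelTriple L 3 v)`
and `w₀` the element with matrix `Φ₃` (★ V1's `hw₀`): `w₀² = 1` because `eA w₀ = w` (★ Z2A-3b) and `w² = 1` (★ `weylLongU_mul_weylLongU`); the dichotomy is ★ Z2A-3a
`mem_inf_or_exists_eq_borel_mul_weylLongU_mul` at `eA(w₀ n w₀) = w·eA(n)·w ∈ N̄_w`, pulled back along `eA` (`eA⁻¹(B_w) = P`: upper triangularity is read entrywise at the one place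
`w`, ★ `coe_eA_apply`, ★ `LocalRing.eq_iff_apply_eq`; `eA⁻¹(I_w) = I` by `hK₀ hK₁ hI`); `θ = 1` is ★ Z2A-3b `theta_eq_one_of_mem_map` at `w₀ n w₀ = w₀ n w₀⁻¹ ∈ N.map (conj w₀)`.
* §1 `w₀_mul_w₀_mem` (`w₀² = 1 ∈ I`), `isClosed_N` (letters `hw`, `hN`).
* §2 `symm_mem_P_of_mem_borelU`, `symm_mem_of_mem_inf`, **`dichotomy_conj`** (letter `hdich`).
* §3 **`theta_conj_eq_one`** (letter `hθ`).
HONEST LABEL: HC_CM is proved only modulo the 7 printed citations (2 remaining named inputs: hLiu418 = stmt-HodgeConjecture-24832, h413 = stmt-HodgeConjecture-24833)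
until rung 0 closes; count-neutral — this file does NOT pay the leaf; no printed citation is discharged.

## References
* [BruhatTits1972] F. Bruhat, J. Tits, Publ. Math. IHÉS 41 (1972), (4.4.3)–(4.4.4) (Iwahori subgroup, the cells `B·I ⊔ B·w·I`).
* [Casselman1995] W. Casselman, *Introduction to the theory of admissible representations of `p`-adic reductive groups* (1995), §6.4.
* [PlatonovRapinchuk1994] V. Platonov, A. Rapinchuk, *Algebraic Groups and Number Theory* (1994), §5.1 (`G(L ⊗ L⁺_v) = G(L_w)` at a non-split place).
* [Rogawski1990] J. Rogawski, Ann. of Math. Stud. 123 (1990), §1.10 p. 9.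
-/

set_option autoImplicit false
-- the mandated namespace has the single-problem summit's repeated segment (`HodgeConjecture.HodgeConjecture`)
set_option linter.dupNamespace false

noncomputable section

open NumberField IsDedekindDomain
open scoped Matrix MatrixGroups WithZero Valued
open Literature.NumberTheory Literature.NumberTheory.Automorphic Literature.NumberTheory.Automorphic.UnitaryGroup
open Literature.NumberTheory.Rogawski1990

namespace Summit.HodgeConjecture.HodgeConjecture.Cruxes.H413.K2E3BranchALettersCM

open Summit.HodgeConjecture.HodgeConjecture.Cruxes.H413
open Summit.HodgeConjecture.HodgeConjecture.Cruxes.H413.K2E3DepthZeroIwahoriCharacterCM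

variable (L : Type) [Field L] [NumberField L] [IsCMField L] (v : HeightOneSpectrum (𝓞 ↥(maximalRealSubfield L)))
  (w : PlacesOver L v) (hw : IsCMField.complexConj L • w.1 = w.1)
  (eA : Gqs L v ≃ₜ* ↥(unitaryGroupOfForm (galAdicCompletionMap (L := L) (IsCMField.complexConj L) hw) ((StdForm.antidiagonal 3).over (w.1.adicCompletion L))))
  (heA : ∀ g : Gqs L v,
    ((eA g : ↥(unitaryGroupOfForm (galAdicCompletionMap (L := L) (IsCMField.complexConj L) hw) ((StdForm.antidiagonal 3).over (w.1.adicCompletion L)))) :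
        GL (Fin 3) (w.1.adicCompletion L)) =
      ((localNonsplitEquiv (IsCMField.complexConj L) (qsForm L) (IsCMField.complexConj_ne_one L) w hw g :
        ↥(unitaryGroupOfForm (galAdicCompletionMap (L := L) (IsCMField.complexConj L) hw) (placeForm (qsForm L) w.1))) : GL (Fin 3) (w.1.adicCompletion L)))
  {ϖ : w.1.adicCompletion L} (hϖ : Valued.v ϖ = WithZero.exp (-1 : ℤ))
  (g₁ : GL (Fin 3) (w.1.adicCompletion L)) (hg₁ : (g₁ : Matrix (Fin 3) (Fin 3) (w.1.adicCompletion L)) = Matrix.diagonal ![(1 : w.1.adicCompletion L), 1, ϖ])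
  (K0 K1 I : Subgroup (Gqs L v))
  (hK0 : K0 = ((glInt 3 (w.1.adicCompletion L)).subgroupOf
    (unitaryGroupOfForm (galAdicCompletionMap (L := L) (IsCMField.complexConj L) hw) ((StdForm.antidiagonal 3).over (w.1.adicCompletion L)))).comap
      eA.toMulEquiv.toMonoidHom)
  (hK1 : K1 = (((glInt 3 (w.1.adicCompletion L)).map (MulAut.conj g₁).toMonoidHom).subgroupOf
    (unitaryGroupOfForm (galAdicCompletionMap (L := L) (IsCMField.complexConj L) hw) ((StdForm.antidiagonal 3).over (w.1.adicCompletion L)))).comap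
      eA.toMulEquiv.toMonoidHom)
  (hI : I = K0 ⊓ K1)
  (t : ParabolicTriple (Gqs L v)) (ht : t = cmBorelTriple L 3 v)
  (w₀ : Gqs L v) (hw₀ : Units.val (w₀.val : GL (Fin 3) (LocalRing L v)) = cmLocalForm L 3 v)

/-! ## §1 `w₀² = 1`; `N` is closed -/

include heA hw₀ in
/-- Letter `hw` of ★ Z2A-4: **`w₀ · w₀ ∈ I`** — indeed `w₀ · w₀ = 1` in `U(Φ₃)(L⁺_v)` (`eA w₀ = w` ★ Z2A-3b, `w·w = 1` ★ `weylLongU_mul_weylLongU`, `eA` injective; cf. the rank-2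
★ `F0P3cStCharTSDomGeneralH.weylElt₂_mul_self`). [cite: Rogawski1990, §1.10 p. 9] [cite: BruhatTits1972, (4.4.4)] -/
theorem w₀_mul_w₀_mem : w₀ * w₀ ∈ I := by
  have hww : w₀ * w₀ = 1 :=
    eA.injective (by rw [map_mul, map_one, map_weyl_eq_weylLongU L v w hw eA heA w₀ hw₀, weylLongU_mul_weylLongU])
  rw [hww]; exact Subgroup.one_mem I

include ht in
/-- Letter `hN` of ★ Z2A-4: `N(L⁺_v)` is closed in `U(Φ₃)(L⁺_v)` (★ `LineRing.isClosed_unipotentU`). [cite: Rogawski1990, §1.10 p. 9] -/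
theorem isClosed_N : IsClosed (t.N : Set (Gqs L v)) := by
  subst ht
  exact LineRing.isClosed_unipotentU (conjLocal L (IsCMField.complexConj L) v) (cmLocalForm L 3 v)

/-! ## §2 The dichotomy «`w₀ n w₀ ∈ I` or `w₀ n w₀ ∈ P · w₀ · I`» -/

include hw heA ht in
/-- `eA⁻¹` of an upper triangular element of the place model is upper triangular, i.e. lies in `P = t.P` (entries read at the one place `w`). [cite: PlatonovRapinchuk1994, §5.1] -/
theorem symm_mem_P_of_mem_borelU
    {p : ↥(unitaryGroupOfForm (galAdicCompletionMap (L := L) (IsCMField.complexConj L) hw) ((StdForm.antidiagonal 3).over (w.1.adicCompletion L)))}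
    (hp : p ∈ borelU (galAdicCompletionMap (L := L) (IsCMField.complexConj L) hw) ((StdForm.antidiagonal 3).over (w.1.adicCompletion L))) :
    eA.symm p ∈ t.P := by
  subst ht
  refine (mem_borelU_iff (σ := conjLocal L (IsCMField.complexConj L) v) (J := cmLocalForm L 3 v)
    (show ↥(unitaryGroupOfForm (conjLocal L (IsCMField.complexConj L) v) (cmLocalForm L 3 v)) from eA.symm p)).2 (fun i j hij => ?_)
  have e : ((((eA.symm p).val : GL (Fin 3) (LocalRing L v)) : Matrix (Fin 3) (Fin 3) (LocalRing L v)) i j) = 0 := by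
    rw [LocalRing.eq_iff_apply_eq (IsCMField.complexConj L) (IsCMField.complexConj_ne_one L) w hw, ← coe_eA_apply L v w hw eA heA (eA.symm p) i j,
      ContinuousMulEquiv.apply_symm_apply, Pi.zero_apply]
    exact (mem_borelU_iff p).1 hp hij
  exact e

include hK0 hK1 hI in
/-- `eA⁻¹` of an element of the place Iwahori lies in `I = K₀ ⊓ K₁`. [cite: BruhatTits1972, (4.4.4)] -/
theorem symm_mem_of_mem_inf
    {κ : ↥(unitaryGroupOfForm (galAdicCompletionMap (L := L) (IsCMField.complexConj L) hw) ((StdForm.antidiagonal 3).over (w.1.adicCompletion L)))}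
    (hκ : κ ∈ (glInt 3 (w.1.adicCompletion L)).subgroupOf
        (unitaryGroupOfForm (galAdicCompletionMap (L := L) (IsCMField.complexConj L) hw) ((StdForm.antidiagonal 3).over (w.1.adicCompletion L))) ⊓
      ((glInt 3 (w.1.adicCompletion L)).map (MulAut.conj g₁).toMonoidHom).subgroupOf
        (unitaryGroupOfForm (galAdicCompletionMap (L := L) (IsCMField.complexConj L) hw) ((StdForm.antidiagonal 3).over (w.1.adicCompletion L)))) :
    eA.symm κ ∈ I := by
  subst hI hK0 hK1
  obtain ⟨h1, h2⟩ := Subgroup.mem_inf.1 hκ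
  rw [← eA.apply_symm_apply κ] at h1 h2
  exact Subgroup.mem_inf.2 ⟨h1, h2⟩

include hw heA hϖ hg₁ hK0 hK1 hI ht hw₀ in
/-- **Letter `hdich` of ★ Z2A-4: for `n ∈ N(L⁺_v)`, `w₀ n w₀ ∈ I` or `w₀ n w₀ = h · w₀ · b′` with `h ∈ P`, `b′ ∈ I`.**  `eA(w₀ n w₀) = w·eA(n)·w ∈ N̄_w` (★ Z2A-3b
`map_mem_unipotentU_of_mem`, `map_weyl_eq_weylLongU`, `w⁻¹ = w`); ★ Z2A-3a `mem_inf_or_exists_eq_borel_mul_weylLongU_mul` in the place model; pull back along `eA`.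
[cite: BruhatTits1972, (4.4.4)] [cite: Casselman1995, Prop. 1.3.1] -/
theorem dichotomy_conj {n : Gqs L v} (hn : n ∈ t.N) :
    w₀ * n * w₀ ∈ I ∨ ∃ h ∈ t.P, ∃ b' ∈ I, w₀ * n * w₀ = h * w₀ * b' := by
  have hσσ : ∀ x, (galAdicCompletionMap (L := L) (IsCMField.complexConj L) hw) ((galAdicCompletionMap (L := L) (IsCMField.complexConj L) hw) x) = x :=
    galAdicCompletionMap_galAdicCompletionMap_of_smul_eq (IsCMField.complexConj L) w (IsCMField.complexConj_ne_one L) hw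
  have hvσ : ∀ x, Valued.v (galAdicCompletionMap (L := L) (IsCMField.complexConj L) hw x) = Valued.v x :=
    fun x => valued_galAdicCompletionMap (L := L) (IsCMField.complexConj L) hw x
  have hwL := map_weyl_eq_weylLongU L v w hw eA heA w₀ hw₀
  have hwLinv : (weylLongU (galAdicCompletionMap (L := L) (IsCMField.complexConj L) hw) (rfl : (StdForm.antidiagonal 3).over (w.1.adicCompletion L) = _))⁻¹ =
      weylLongU (galAdicCompletionMap (L := L) (IsCMField.complexConj L) hw) rfl :=
    inv_eq_of_mul_eq_one_right (weylLongU_mul_weylLongU _ _)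
  -- `eA (w₀ n w₀) ∈ N̄_w`
  have hx : eA (w₀ * n * w₀) ∈
      ((borelTriple (galAdicCompletionMap (L := L) (IsCMField.complexConj L) hw) ((StdForm.antidiagonal 3).over (w.1.adicCompletion L)) rfl).N).map
        (MulAut.conj (weylLongU (galAdicCompletionMap (L := L) (IsCMField.complexConj L) hw)
          (rfl : (StdForm.antidiagonal 3).over (w.1.adicCompletion L) = _))).toMonoidHom := by
    refine Subgroup.mem_map.2 ⟨eA n, map_mem_unipotentU_of_mem L v w hw eA heA t ht hn, ?_⟩
    rw [MulEquiv.coe_toMonoidHom, MulAut.conj_apply, map_mul, map_mul, hwL, hwLinv]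
  rcases K2E3LowerUnipotentBorelIwahori.mem_inf_or_exists_eq_borel_mul_weylLongU_mul _ rfl hσσ hvσ hϖ g₁ hg₁ hx with h | ⟨p, hp, κ, hκ, e⟩
  · left
    have h' := symm_mem_of_mem_inf L v w hw eA g₁ K0 K1 I hK0 hK1 hI (κ := eA (w₀ * n * w₀)) h
    rwa [ContinuousMulEquiv.symm_apply_apply] at h'
  · right
    refine ⟨eA.symm p, symm_mem_P_of_mem_borelU L v w hw eA heA t ht hp, eA.symm κ, symm_mem_of_mem_inf L v w hw eA g₁ K0 K1 I hK0 hK1 hI hκ, ?_⟩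
    apply eA.injective
    rw [e, map_mul, map_mul, ContinuousMulEquiv.apply_symm_apply, ContinuousMulEquiv.apply_symm_apply, hwL]

/-! ## §3 `θ(w₀ n w₀) = 1` -/

open Classical in
include hw heA ht hw₀ in
/-- **Letter `hθ` of ★ Z2A-4: `θ(w₀ n w₀) = 1` for `n ∈ N(L⁺_v)`** (`w₀ n w₀ = w₀ n w₀⁻¹ ∈ N.map (conj w₀)`; ★ Z2A-3b `theta_eq_one_of_mem_map`) for the depth-zero character
`θ(g) = if h : IsUnit g₀₀ then χ₁(h.unit) else 0`. [cite: BruhatTits1972, (4.4.4)] -/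
theorem theta_conj_eq_one (χ₁ : (LocalRing L v)ˣ →* ℂˣ) {n : Gqs L v} (hn : n ∈ t.N) :
    (if h : IsUnit ((((w₀ * n * w₀).val : GL (Fin 3) (LocalRing L v)) : Matrix (Fin 3) (Fin 3) (LocalRing L v)) 0 0) then ((χ₁ h.unit : ℂˣ) : ℂ) else 0) = 1 :=
  theta_eq_one_of_mem_map L v w hw eA heA χ₁ t ht w₀ hw₀
    (Subgroup.mem_map.2 ⟨n, hn, by
      rw [MulEquiv.coe_toMonoidHom, MulAut.conj_apply, inv_eq_of_mul_eq_one_right (eA.injective (by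
        rw [map_mul, map_one, map_weyl_eq_weylLongU L v w hw eA heA w₀ hw₀, weylLongU_mul_weylLongU]) : w₀ * w₀ = 1)]⟩)

end Summit.HodgeConjecture.HodgeConjecture.Cruxes.H413.K2E3BranchALettersCM

end
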